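import Summits.CriticalPhenomena.CardyFormulaZ2.Theorems.CardySusyWardParafermionFamiliesToSLESixFreeTraceDirectionA
import Summits.CriticalPhenomena.CardyFormulaZ2.Theorems.CardySusyWardParafermionFamiliesToSLESixTouchLowerBoundC
import Summits.CriticalPhenomena.CardyFormulaZ2.Theorems.CardySusyWardParafermionFamiliesToSLESixFacePotential

/-!
# The boundary trace of the corner flow along a flat diagonal free side (helper `freeTrace_direction_diag` of
# `stub_traceIdentification`, line `exact-potential-schwarz-christoffel`, crux stmt-CriticalPhenomena-10814), B:
# one turn count for the whole side

Setting: the WALL PACKAGE of a flat diagonal piece of the free arc (the three lattice conclusions of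
`TouchLowerBound.wall_package`, taken as hypotheses on admissible data `E` with hole-free inner faces): diagonal
level `a v₀ + b v₁` and column `a v₀ - b v₁`, `(a, b) = u_j + u_{j+1}` (`u = cornerUnit`; this fixes the TOUCH INDEX
`j : Fin 4` of the side, `exists_touchIndex`), last level `k` under the line (`c ≤ δ (k + 1)`), lattice neighbours of
the core `{|δ column - t₀| ≤ 5wτ/8, c - 3wν/4 ≤ δ level ≤ δ k}` are `Ω_δ`-adjacent, core sites of level `≤ k - 2`
(margin `2δ`) are off both discrete arcs, core sites of level `k - 1` are on the dual-wired arc `B`.  The TOUCH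
SITES of the side are the sites `x` of level `k - 2` (columns `|δ column - t₀| ≤ 5wτ/8 - 4δ`); the boundary darts
at `x` are the touch dart `(x, j)` (face `faceAt x j`, whose corners `x + u_j`, `x + u_{j+1}` lie on `B`), the
outgoing dart `(x, j + 1)` and the ingoing dart `(x, j + 3)` (faces `faceAt x (j+1)`, `faceAt x (j+3)`: the two
VALLEY FACES at `x`, shared with the next / previous touch site, `FreeTrace.faceAt_next_in`) — THREE boundary darts
per touch site, all of inner faces with a `B`-corner, so that the free-arc touch law (`CornerForm.freeArc_touch_law`)
applies to each.  Plugging in: for a family `Λ` of `P` and `E = Λ δ`, the hypotheses `hadj`, `hoff`, `honB` below are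
VERBATIM the last three conclusions of `TouchLowerBound.wall_package` (with its `k`, `0 < δ`, `c ≤ δ (k + 1)`,
`16 δ ≤ wν`), `hj` comes from `FreeTrace.exists_touchIndex ha hb`, hole-freeness from `holeFree_innerFaces`.

**Theorem** (`freeTrace_direction`, registered one-line form `freeTrace_direction_diag`). *There is ONE integer
`τ₀` (depending on `E` and the piece, NOT on the touch site) such that for every touch site `x` of the piece:
(A) in EVERY configuration every visit of `(x, j)`, `(x, j+1)`, `(x, j+3)` by the exploration has turn count
`τ₀`, `τ₀ + 1`, `τ₀ - 1`; (B) `cornerObs E δ x (faceAt x j) = sixthPhase τ₀ · P[x ↔ A]`,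
`cornerObs E δ x (faceAt x (j+1)) = sixthPhase (τ₀+1) · P[x ↔ A]`, `cornerObs E δ x (faceAt x (j+3)) = sixthPhase (τ₀-1) · P[x ↔ A]`;
(C) if `P[x ↔ A] > 0` the all-open phases `cornerPhase δ E x · univ` of the three darts ARE these sixth roots, and
`τ₀ ≡ j - j₀ (mod 4)`, `j₀` the face index of the start corner (`turnCount_emod_four`: the direction of the touch dart);
(D) the increment of the face potential across `x`, from the ingoing valley face to the outgoing one,
`cornerObs·dir (x, j+3) - cornerObs·dir (x, j+1)`, equals `√3 · ζ · P[x ↔ A]` with the unit vector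
`ζ = sixthPhase τ₀ · √2 (-1+i)/2 · i^{j+3}` (`FreeTrace.norm_tracePhase`) — the trace of the potential on the valley
faces of the side is COLLINEAR (direction `ζ`) and MONOTONE.*

Proof: in the all-open configuration a touch `(x, j)` forces the next four darts up to the next touch
`(x', j)`, `x' = x + u_{j+2} + u_{j+1}`, with the same turn count (`FreeTrace.touch_step`); iterating along the side
(`touch_transport`) and the injectivity of the cut orbit (`S5.orbit_inj`) make the all-open turn count the same at
all touch sites of the piece, TouchPhase (`CornerForm.turnCount_touch`) transfers it to every configuration, and
`FreeTrace.turnCount_out/in`, `FreeTrace.cornerObs_dart_of_turnCount`, `FacePotential.dart_dir_faceAt` evaluate.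

CAVEAT: `τ₀` is NOT a function of `(a, b, j)` alone — it is the number of left minus right quarter turns of the
all-open exploration (the `B`-staircase) from the start corner to the piece; a spiralling free arc adds `± 4` per full
turn (`sixthPhase τ₀` changes by `e^{∓ 2π i/3}`), as the boundary argument of the continuum observable is the continuous
branch of `arg (Φ′)^{1/3}` along `∂P`; only `τ₀ ≡ j - j₀ (mod 4)` (`j₀` the face index of the start corner) is pinned.
-/

noncomputable section

namespace Summit.CriticalPhenomena.CardyFormulaZ2.Theorems.ParafermionFamiliesToSLESix.FreeTrace

open MeasureTheory Complex
open Literature.Probability.Percolation (bondPercolation half BondConfig openGraph)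
open Literature.Probability.LatticeModels
open Literature.Probability.LatticeModels.DiscreteDobrushin (startCorner exitTime isStartCorner_startCorner
  isInnerFace_of_lt_exitTime not_isInnerFace_exitTime)
open Summit.CriticalPhenomena.CardyFormulaZ2.Cruxes.EdgePrecompact.QkzStripBoundaryArm (cornerObs)
open Summit.CriticalPhenomena.CardyFormulaZ2.Cruxes.CoherentMorera.FinitaryGreenPairing (cornerPhase)
open Summit.CriticalPhenomena.CardyFormulaZ2.Theorems.ParafermionFamiliesToSLESix.StripAnchored
open Summit.CriticalPhenomena.CardyFormulaZ2.Theorems.ParafermionFamiliesToSLESix.TouchLowerBound (near_of_adj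
  near_of_isCorner box_of_near)
open S2 (sixthPhase)
open FacePotential (dart_dir_faceAt)

variable {E : DiscreteDobrushin} {δ c t₀ wτ wν : ℝ} {a b k : ℤ} {j : Fin 4}

/-! ## Local geometry of a touch site in the wall package -/

/-- **Every face at a touch site is inner** (its corners lie within two levels and columns, at level `≤ k`,
hence in the core, whose lattice neighbours are `Ω_δ`-adjacent). [folklore] -/
theorem isInnerFace_of_touchSite (ha : a = 1 ∨ a = -1) (hb : b = 1 ∨ b = -1) (hδ : 0 < δ) (hk' : c ≤ δ * (k + 1))
    (hδν : 16 * δ ≤ wν)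
    (hadj : ∀ u w : Site 2, (zdGraph 2).Adj u w →
      |δ * ((a * u 0 - b * u 1 : ℤ) : ℝ) - t₀| ≤ 5 * wτ / 8 → c - 3 * wν / 4 ≤ δ * ((a * u 0 + b * u 1 : ℤ) : ℝ) →
      a * u 0 + b * u 1 ≤ k →
      |δ * ((a * w 0 - b * w 1 : ℤ) : ℝ) - t₀| ≤ 5 * wτ / 8 → c - 3 * wν / 4 ≤ δ * ((a * w 0 + b * w 1 : ℤ) : ℝ) →
      a * w 0 + b * w 1 ≤ k → (discreteDomainGraph E.Ω E.δ).Adj u w)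
    {x f : Site 2} (hxf : IsCorner x f) (hx : a * x 0 + b * x 1 = k - 2)
    (hxτ : |δ * ((a * x 0 - b * x 1 : ℤ) : ℝ) - t₀| ≤ 5 * wτ / 8 - 2 * δ) : E.IsInnerFace f := by
  -- adapted from `TouchLowerBound.not_mem_zdBoundary_of_core` (the four faces of a deep core site are inner)
  have hxl : δ * ((a * x 0 + b * x 1 : ℤ) : ℝ) = δ * (k + 1) - 3 * δ := by rw [hx]; push_cast; ring
  have hν : c - 3 * wν / 4 + 2 * δ ≤ δ * ((a * x 0 + b * x 1 : ℤ) : ℝ) := by rw [hxl]; linarith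
  intro w w' hw hw' hww'
  have hnw := near_of_isCorner ha hb hxf hw
  have hnw' := near_of_isCorner ha hb hxf hw'
  have hbw := box_of_near (t₀ := t₀) (m := 2) (T := 5 * wτ / 8) (N := c - 3 * wν / 4) hδ.le hnw
    (by simp only [Nat.cast_ofNat]; linarith) (by simp only [Nat.cast_ofNat]; linarith)
  have hbw' := box_of_near (t₀ := t₀) (m := 2) (T := 5 * wτ / 8) (N := c - 3 * wν / 4) hδ.le hnw'
    (by simp only [Nat.cast_ofNat]; linarith) (by simp only [Nat.cast_ofNat]; linarith)
  have := (abs_le.1 hnw.1).2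
  have := (abs_le.1 hnw'.1).2
  exact hadj w w' hww' hbw.1 hbw.2 (by omega) hbw'.1 hbw'.2 (by omega)

/-- **Lattice neighbours within two levels and columns of a touch site are `Ω_δ`-adjacent.** [folklore] -/
theorem adj_of_touchSite (hδ : 0 < δ) (hk' : c ≤ δ * (k + 1)) (hδν : 16 * δ ≤ wν)
    (hadj : ∀ u w : Site 2, (zdGraph 2).Adj u w →
      |δ * ((a * u 0 - b * u 1 : ℤ) : ℝ) - t₀| ≤ 5 * wτ / 8 → c - 3 * wν / 4 ≤ δ * ((a * u 0 + b * u 1 : ℤ) : ℝ) →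
      a * u 0 + b * u 1 ≤ k →
      |δ * ((a * w 0 - b * w 1 : ℤ) : ℝ) - t₀| ≤ 5 * wτ / 8 → c - 3 * wν / 4 ≤ δ * ((a * w 0 + b * w 1 : ℤ) : ℝ) →
      a * w 0 + b * w 1 ≤ k → (discreteDomainGraph E.Ω E.δ).Adj u w)
    {x u w : Site 2} (hx : a * x 0 + b * x 1 = k - 2) (hxτ : |δ * ((a * x 0 - b * x 1 : ℤ) : ℝ) - t₀| ≤ 5 * wτ / 8 - 2 * δ)
    (hu : |(a * u 0 + b * u 1) - (a * x 0 + b * x 1)| ≤ 2 ∧ |(a * u 0 - b * u 1) - (a * x 0 - b * x 1)| ≤ 2)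
    (hw : |(a * w 0 + b * w 1) - (a * x 0 + b * x 1)| ≤ 2 ∧ |(a * w 0 - b * w 1) - (a * x 0 - b * x 1)| ≤ 2)
    (huw : (zdGraph 2).Adj u w) : (discreteDomainGraph E.Ω E.δ).Adj u w := by
  have hxl : δ * ((a * x 0 + b * x 1 : ℤ) : ℝ) = δ * (k + 1) - 3 * δ := by rw [hx]; push_cast; ring
  have hν : c - 3 * wν / 4 + 2 * δ ≤ δ * ((a * x 0 + b * x 1 : ℤ) : ℝ) := by rw [hxl]; linarith
  have hbu := box_of_near (t₀ := t₀) (m := 2) (T := 5 * wτ / 8) (N := c - 3 * wν / 4) hδ.le hu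
    (by simp only [Nat.cast_ofNat]; linarith) (by simp only [Nat.cast_ofNat]; linarith)
  have hbw := box_of_near (t₀ := t₀) (m := 2) (T := 5 * wτ / 8) (N := c - 3 * wν / 4) hδ.le hw
    (by simp only [Nat.cast_ofNat]; linarith) (by simp only [Nat.cast_ofNat]; linarith)
  have := (abs_le.1 hu.1).2
  have := (abs_le.1 hw.1).2
  exact hadj u w huw hbu.1 hbu.2 (by omega) hbw.1 hbw.2 (by omega)

/-- **Sites of level `k - 2` or `k - 3` near the piece are off both arcs.** [folklore] -/
theorem not_mem_arcs_of_level (hδ : 0 < δ) (hk' : c ≤ δ * (k + 1)) (hδν : 16 * δ ≤ wν)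
    (hoff : ∀ v : Site 2, |δ * ((a * v 0 - b * v 1 : ℤ) : ℝ) - t₀| ≤ 5 * wτ / 8 - 2 * δ →
      c - 3 * wν / 4 + 2 * δ ≤ δ * ((a * v 0 + b * v 1 : ℤ) : ℝ) → a * v 0 + b * v 1 ≤ k - 2 →
      v ∉ E.zdArcA ∧ v ∉ E.zdArcB)
    {v : Site 2} (hvτ : |δ * ((a * v 0 - b * v 1 : ℤ) : ℝ) - t₀| ≤ 5 * wτ / 8 - 2 * δ) (h1 : k - 3 ≤ a * v 0 + b * v 1)
    (h2 : a * v 0 + b * v 1 ≤ k - 2) : v ∉ E.zdArcA ∧ v ∉ E.zdArcB := by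
  refine hoff v hvτ ?_ h2
  have h1' : (k : ℝ) - 3 ≤ ((a * v 0 + b * v 1 : ℤ) : ℝ) := by exact_mod_cast h1
  have := mul_le_mul_of_nonneg_left h1' hδ.le
  linarith

/-- An `Ω_δ`-edge with both endpoints off the arc `B` is open in the completed ALL-OPEN configuration.
[cite: Smirnov2001, §2] -/
theorem mem_bcBondConfig_univ {u w : Site 2} (h : (discreteDomainGraph E.Ω E.δ).Adj u w) (hu : u ∉ E.zdArcB)
    (hw : w ∉ E.zdArcB) : s(u, w) ∈ E.bcBondConfig (Set.univ : BondConfig (Site 2)) := by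
  rw [DiscreteDobrushin.mem_bcBondConfig_iff]
  refine ⟨(SimpleGraph.mem_edgeSet _).2 h, Or.inr ⟨Set.mem_univ _, fun z hz => ?_⟩⟩
  rcases Sym2.mem_iff.1 hz with rfl | rfl
  exacts [hu, hw]

/-! ## The all-open exploration along the side -/

section Wall

variable (hE : E.IsZdAdmissible)
  (hj : (Pi.single 0 a + Pi.single 1 b : Site 2) = cornerUnit j + cornerUnit (j + 1))
  (hδ : 0 < δ) (hk' : c ≤ δ * (k + 1)) (hδν : 16 * δ ≤ wν)
  (hadj : ∀ u w : Site 2, (zdGraph 2).Adj u w →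
    |δ * ((a * u 0 - b * u 1 : ℤ) : ℝ) - t₀| ≤ 5 * wτ / 8 → c - 3 * wν / 4 ≤ δ * ((a * u 0 + b * u 1 : ℤ) : ℝ) →
    a * u 0 + b * u 1 ≤ k →
    |δ * ((a * w 0 - b * w 1 : ℤ) : ℝ) - t₀| ≤ 5 * wτ / 8 → c - 3 * wν / 4 ≤ δ * ((a * w 0 + b * w 1 : ℤ) : ℝ) →
    a * w 0 + b * w 1 ≤ k → (discreteDomainGraph E.Ω E.δ).Adj u w)
  (hoff : ∀ v : Site 2, |δ * ((a * v 0 - b * v 1 : ℤ) : ℝ) - t₀| ≤ 5 * wτ / 8 - 2 * δ →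
    c - 3 * wν / 4 + 2 * δ ≤ δ * ((a * v 0 + b * v 1 : ℤ) : ℝ) → a * v 0 + b * v 1 ≤ k - 2 →
    v ∉ E.zdArcA ∧ v ∉ E.zdArcB)
  (honB : ∀ y : Site 2, |δ * ((a * y 0 - b * y 1 : ℤ) : ℝ) - t₀| ≤ 5 * wτ / 8 - 2 * δ → a * y 0 + b * y 1 = k - 1 →
    y ∈ E.zdArcB)
include hE hj hδ hk' hδν hadj hoff honB

/-- **One step along the side in the all-open configuration**: a touch `orb n = (x, j)` of a touch site `x`
(level `k - 2`, `|δ column - t₀| ≤ 5wτ/8 - 4δ`) is followed four darts later by the touch of the next site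
`x' = x + u_{j+2} + u_{j+1}`, with the same turn count (`FreeTrace.touch_step`: `x + u_{j+1} ∈ B`, the valley face
and the next touch face are inner, the two edges `s(x, x + u_{j+2})`, `s(x + u_{j+2}, x')` are `Ω_δ`-edges off `B`,
open). [cite: Smirnov2001, §2] -/
theorem touch_step_univ {x : Site 2} (hx : a * x 0 + b * x 1 = k - 2)
    (hxτ : |δ * ((a * x 0 - b * x 1 : ℤ) : ℝ) - t₀| ≤ 5 * wτ / 8 - 4 * δ) {n : ℕ} (hn : n < exitTime hE Set.univ)
    (h : cornerOrbit (E.bcBondConfig Set.univ) (startCorner hE) n = (x, j)) :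
    n + 4 < exitTime hE Set.univ ∧
      cornerOrbit (E.bcBondConfig Set.univ) (startCorner hE) (n + 4) = (x + cornerUnit (j + 2) + cornerUnit (j + 1), j) ∧
      turnCount (E.bcBondConfig Set.univ) (startCorner hE) (n + 4) = turnCount (E.bcBondConfig Set.univ) (startCorner hE) n := by
  obtain ⟨ha, hb, -, hl1, hl2, hc2, -⟩ := coords_of_touchIndex hj
  set x₂ : Site 2 := x + cornerUnit (j + 2) with hx₂
  set x' : Site 2 := x + cornerUnit (j + 2) + cornerUnit (j + 1) with hx'
  -- integer proximity of the sites involved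
  have hn1 := near_of_adj ha hb (zdGraph_adj_add_cornerUnit x (j + 1))
  have hn2 := near_of_adj ha hb (zdGraph_adj_add_cornerUnit x (j + 2))
  have hn2' := near_of_adj ha hb (zdGraph_adj_add_cornerUnit x₂ (j + 1))
  have hx0 : |(a * x 0 + b * x 1) - (a * x 0 + b * x 1)| ≤ 2 ∧ |(a * x 0 - b * x 1) - (a * x 0 - b * x 1)| ≤ 2 := by simp
  have hx₂n : |(a * x₂ 0 + b * x₂ 1) - (a * x 0 + b * x 1)| ≤ 2 ∧ |(a * x₂ 0 - b * x₂ 1) - (a * x 0 - b * x 1)| ≤ 2 :=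
    ⟨hn2.1.trans (by norm_num), hn2.2.trans (by norm_num)⟩
  have hx'n : |(a * x' 0 + b * x' 1) - (a * x 0 + b * x 1)| ≤ 2 ∧ |(a * x' 0 - b * x' 1) - (a * x 0 - b * x 1)| ≤ 2 := by
    obtain ⟨p1, p2⟩ := hn2
    obtain ⟨q1, q2⟩ := hn2'
    rw [abs_le] at p1 p2 q1 q2 ⊢
    rw [abs_le]
    constructor <;> constructor <;> linarith [p1.1, p1.2, p2.1, p2.2, q1.1, q1.2, q2.1, q2.2]
  -- levels
  have hl1' : a * (x + cornerUnit (j + 1)) 0 + b * (x + cornerUnit (j + 1)) 1 = k - 1 := by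
    simp only [Pi.add_apply]; linear_combination hx + hl1
  have hl2' : a * x₂ 0 + b * x₂ 1 = k - 3 := by
    simp only [hx₂, Pi.add_apply]; linear_combination hx + hl2
  have hl3' : a * x' 0 + b * x' 1 = k - 2 := by
    simp only [hx', Pi.add_apply]; linear_combination hx + hl2 + hl1
  -- columns
  have hτx : |δ * ((a * x 0 - b * x 1 : ℤ) : ℝ) - t₀| ≤ 5 * wτ / 8 - 2 * δ := hxτ.trans (by linarith)
  have hτ1 : |δ * ((a * (x + cornerUnit (j + 1)) 0 - b * (x + cornerUnit (j + 1)) 1 : ℤ) : ℝ) - t₀| ≤ 5 * wτ / 8 - 2 * δ :=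
    col_of_near (m := 1) hδ.le hn1.2 (by simp only [Nat.cast_one]; linarith)
  have hτ2 : |δ * ((a * x₂ 0 - b * x₂ 1 : ℤ) : ℝ) - t₀| ≤ 5 * wτ / 8 - 2 * δ :=
    col_of_near (m := 1) hδ.le hn2.2 (by simp only [Nat.cast_one]; linarith)
  have hτ3 : |δ * ((a * x' 0 - b * x' 1 : ℤ) : ℝ) - t₀| ≤ 5 * wτ / 8 - 2 * δ :=
    col_of_near (m := 2) hδ.le hx'n.2 (by simp only [Nat.cast_ofNat]; linarith)
  -- the inputs of `touch_step`
  have hB1 : x + cornerUnit (j + 1) ∈ E.zdArcB := honB _ hτ1 hl1'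
  have hf1 : E.IsInnerFace (faceAt x (j + 1)) :=
    isInnerFace_of_touchSite ha hb hδ hk' hδν hadj (isCorner_faceAt x (j + 1)) hx hτx
  have hf2 : E.IsInnerFace (faceAt x' j) :=
    isInnerFace_of_touchSite ha hb hδ hk' hδν hadj (isCorner_faceAt x' j) hl3' hτ3
  have hxB : x ∉ E.zdArcB := (not_mem_arcs_of_level hδ hk' hδν hoff hτx (by omega) hx.le).2
  have hx₂B : x₂ ∉ E.zdArcB := (not_mem_arcs_of_level hδ hk' hδν hoff hτ2 (by omega) (by omega)).2
  have hx'B : x' ∉ E.zdArcB := (not_mem_arcs_of_level hδ hk' hδν hoff hτ3 (by omega) hl3'.le).2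
  have ho1 : s(x, x₂) ∈ E.bcBondConfig Set.univ :=
    mem_bcBondConfig_univ (adj_of_touchSite hδ hk' hδν hadj hx hτx hx0 hx₂n (zdGraph_adj_add_cornerUnit x (j + 2))) hxB hx₂B
  have ho2 : s(x₂, x') ∈ E.bcBondConfig Set.univ :=
    mem_bcBondConfig_univ (adj_of_touchSite hδ hk' hδν hadj hx hτx hx₂n hx'n (zdGraph_adj_add_cornerUnit x₂ (j + 1))) hx₂B hx'B
  obtain ⟨h4, -, -, -, horb, -, -, -, htc⟩ := touch_step hE hB1 hf1 hf2 hn h ho1 ho2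
  exact ⟨h4, horb, htc⟩

/-- **Transport along the side.** In the all-open configuration a touch of the touch site `x` at time `n` is
followed, `4m` darts later, by the touch of the touch site `y` of column `column x + 2σm` (`σ = ±1` the column
sign of `u_{j+1}`), with the same turn count. [cite: Smirnov2010, proof of Lemma 4.5] -/
theorem touch_transport (m : ℕ) : ∀ (x y : Site 2) (n : ℕ), a * x 0 + b * x 1 = k - 2 →
    |δ * ((a * x 0 - b * x 1 : ℤ) : ℝ) - t₀| ≤ 5 * wτ / 8 - 4 * δ → a * y 0 + b * y 1 = k - 2 →
    |δ * ((a * y 0 - b * y 1 : ℤ) : ℝ) - t₀| ≤ 5 * wτ / 8 - 4 * δ →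
    a * y 0 - b * y 1 = a * x 0 - b * x 1 + m * (2 * (a * (cornerUnit (j + 1)) 0 - b * (cornerUnit (j + 1)) 1)) →
    n < exitTime hE Set.univ → cornerOrbit (E.bcBondConfig Set.univ) (startCorner hE) n = (x, j) →
    n + 4 * m < exitTime hE Set.univ ∧ cornerOrbit (E.bcBondConfig Set.univ) (startCorner hE) (n + 4 * m) = (y, j) ∧
      turnCount (E.bcBondConfig Set.univ) (startCorner hE) (n + 4 * m) =
        turnCount (E.bcBondConfig Set.univ) (startCorner hE) n := by
  obtain ⟨ha, hb, -, hl1, hl2, hc2, -⟩ := coords_of_touchIndex hj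
  induction m with
  | zero =>
    intro x y n hx hxτ hy hyτ hcol hn h
    simp only [Nat.cast_zero, zero_mul, add_zero] at hcol
    obtain rfl : x = y := eq_of_level_column ha hb (hx.trans hy.symm) hcol.symm
    simpa using And.intro hn h
  | succ m ih =>
    intro x y n hx hxτ hy hyτ hcol hn h
    set x' : Site 2 := x + cornerUnit (j + 2) + cornerUnit (j + 1) with hx'
    have hl3' : a * x' 0 + b * x' 1 = k - 2 := by
      simp only [hx', Pi.add_apply]; linear_combination hx + hl2 + hl1
    have hc3' : a * x' 0 - b * x' 1 = a * x 0 - b * x 1 + 2 * (a * (cornerUnit (j + 1)) 0 - b * (cornerUnit (j + 1)) 1) := by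
      simp only [hx', Pi.add_apply]; linear_combination hc2
    have hτ' : |δ * ((a * x' 0 - b * x' 1 : ℤ) : ℝ) - t₀| ≤ 5 * wτ / 8 - 4 * δ := by
      have e1 : δ * ((a * x' 0 - b * x' 1 : ℤ) : ℝ) - t₀ = (δ * ((a * x 0 - b * x 1 : ℤ) : ℝ) - t₀) +
          δ * (2 * ((a * (cornerUnit (j + 1)) 0 - b * (cornerUnit (j + 1)) 1 : ℤ) : ℝ)) := by
        rw [hc3']; push_cast; ring
      have e2 : δ * ((a * y 0 - b * y 1 : ℤ) : ℝ) - t₀ = (δ * ((a * x 0 - b * x 1 : ℤ) : ℝ) - t₀) +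
          ((m : ℝ) + 1) * (δ * (2 * ((a * (cornerUnit (j + 1)) 0 - b * (cornerUnit (j + 1)) 1 : ℤ) : ℝ))) := by
        rw [hcol]; push_cast; ring
      rw [e1]
      rw [e2] at hyτ
      exact abs_step_le m hxτ hyτ
    obtain ⟨hn4, h4, htc4⟩ := touch_step_univ hE hj hδ hk' hδν hadj hoff honB hx hxτ hn h
    have hcol' : a * y 0 - b * y 1 = a * x' 0 - b * x' 1 + m * (2 * (a * (cornerUnit (j + 1)) 0 - b * (cornerUnit (j + 1)) 1)) := by
      rw [hc3', hcol]; push_cast; ring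
    obtain ⟨hlt, horb, htc⟩ := ih x' y (n + 4) hl3' hτ' hy hyτ hcol' hn4 h4
    rw [show n + 4 * (m + 1) = n + 4 + 4 * m by ring]
    exact ⟨hlt, horb, htc.trans htc4⟩

/-- **One all-open turn count for the whole side.** There is `τ₀ ∈ ℤ` such that every visit, in ANY
configuration, of the touch dart `(x, j)` of ANY touch site `x` of the piece has turn count `τ₀` (all-open
transport along the side + injectivity of the cut orbit + TouchPhase). [cite: DuminilCopin2012Parafermion, Proposition 5] -/
theorem exists_turnCount_touch (hH : HoleFree {f : Site 2 | E.IsInnerFace f}) :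
    ∃ τ₀ : ℤ, ∀ x : Site 2, a * x 0 + b * x 1 = k - 2 → |δ * ((a * x 0 - b * x 1 : ℤ) : ℝ) - t₀| ≤ 5 * wτ / 8 - 4 * δ →
      ∀ (ω : BondConfig (Site 2)) (n : ℕ), n < exitTime hE ω →
        cornerOrbit (E.bcBondConfig ω) (startCorner hE) n = (x, j) → turnCount (E.bcBondConfig ω) (startCorner hE) n = τ₀ := by
  classical
  obtain ⟨ha, hb, -, hl1, -, -, hσ⟩ := coords_of_touchIndex hj
  set σ : ℤ := a * (cornerUnit (j + 1)) 0 - b * (cornerUnit (j + 1)) 1 with hσdef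
  have hσ2 : σ * σ = 1 := by rcases hσ with h | h <;> rw [h] <;> norm_num
  -- local structure of a touch site: the touch face is inner with the `B`-corner `x + u_{j+1}`
  have hloc : ∀ x : Site 2, a * x 0 + b * x 1 = k - 2 → |δ * ((a * x 0 - b * x 1 : ℤ) : ℝ) - t₀| ≤ 5 * wτ / 8 - 4 * δ →
      E.IsInnerFace (cFace (x, j)) ∧ IsCorner (x + cornerUnit (j + 1)) (cFace (x, j)) ∧ x + cornerUnit (j + 1) ∈ E.zdArcB := by
    intro x hx hxτ
    have hn1 := near_of_adj ha hb (zdGraph_adj_add_cornerUnit x (j + 1))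
    refine ⟨isInnerFace_of_touchSite ha hb hδ hk' hδν hadj (isCorner_faceAt x j) hx (hxτ.trans (by linarith)),
      (isCorner_add_faceAt_iff x (j + 1) j).2 (Or.inr (fin4_add_one_add_three j).symm), honB _ ?_ ?_⟩
    · exact col_of_near (m := 1) hδ.le hn1.2 (by simp only [Nat.cast_one]; linarith)
    · simp only [Pi.add_apply]; linear_combination hx + hl1
  have hinj : ∀ {m m' : ℕ}, m < exitTime hE Set.univ → m' < exitTime hE Set.univ →
      cornerOrbit (E.bcBondConfig Set.univ) (startCorner hE) m = cornerOrbit (E.bcBondConfig Set.univ) (startCorner hE) m' →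
      m = m' := fun hm hm' h =>
    S5.orbit_inj hE (fun k hk => isInnerFace_of_lt_exitTime hE _ hk) hm hm' h
  by_cases hV : ∃ x₀ : Site 2, ∃ n₀ : ℕ, a * x₀ 0 + b * x₀ 1 = k - 2 ∧
      |δ * ((a * x₀ 0 - b * x₀ 1 : ℤ) : ℝ) - t₀| ≤ 5 * wτ / 8 - 4 * δ ∧ n₀ < exitTime hE Set.univ ∧
      cornerOrbit (E.bcBondConfig Set.univ) (startCorner hE) n₀ = (x₀, j)
  · obtain ⟨x₀, n₀, hx₀, hx₀τ, hn₀, h₀⟩ := hV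
    refine ⟨turnCount (E.bcBondConfig Set.univ) (startCorner hE) n₀, fun x hx hxτ ω n hn h => ?_⟩
    obtain ⟨hf, hy, hyB⟩ := hloc x hx hxτ
    -- TouchPhase: reduce to the all-open visit of `(x, j)`
    obtain ⟨m, hm, hmr⟩ := CornerForm.touch_mono hE hH hf hy hyB (Set.subset_univ ω) h
    rw [CornerForm.turnCount_touch hE hH hf hy hyB hn hm h hmr]
    -- `x` and `x₀` differ by `q` periods of the side
    obtain ⟨q, hq⟩ : ∃ q : ℤ, a * x 0 - b * x 1 = a * x₀ 0 - b * x₀ 1 + q * (2 * σ) :=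
      ⟨-b * (x 1 - x₀ 1) * σ, by linear_combination hx - hx₀ + (2 * b * (x 1 - x₀ 1)) * hσ2⟩
    rcases le_or_gt 0 q with hq0 | hq0
    · -- `x` downstream of `x₀`
      have hq' : a * x 0 - b * x 1 = a * x₀ 0 - b * x₀ 1 + (q.toNat : ℕ) * (2 * σ) := by
        rw [hq, Int.toNat_of_nonneg hq0]
      obtain ⟨hlt, horb, htc⟩ := touch_transport hE hj hδ hk' hδν hadj hoff honB q.toNat x₀ x n₀ hx₀ hx₀τ hx hxτ hq' hn₀ h₀
      rw [hinj hm hlt (hmr.trans horb.symm), htc]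
    · -- `x` upstream of `x₀`
      have hq' : a * x₀ 0 - b * x₀ 1 = a * x 0 - b * x 1 + ((-q).toNat : ℕ) * (2 * σ) := by
        rw [hq, Int.toNat_of_nonneg (by omega)]; ring
      obtain ⟨hlt, horb, htc⟩ := touch_transport hE hj hδ hk' hδν hadj hoff honB (-q).toNat x x₀ m hx hxτ hx₀ hx₀τ hq' hm hmr
      rw [hinj hn₀ hlt (h₀.trans horb.symm), htc]
  · refine ⟨0, fun x hx hxτ ω n hn h => absurd ?_ hV⟩
    obtain ⟨hf, hy, hyB⟩ := hloc x hx hxτ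
    obtain ⟨m, hm, hmr⟩ := CornerForm.touch_mono hE hH hf hy hyB (Set.subset_univ ω) h
    exact ⟨x, m, hx, hxτ, hm, hmr⟩

/-- **The boundary trace of the corner flow along a flat diagonal free side** (see the module docstring): one
turn count `τ₀` for the whole piece; (A) the turn counts `τ₀, τ₀ + 1, τ₀ - 1` of the touch / outgoing / ingoing
darts of every touch site in every configuration, (B) the three corner observables `sixthPhase · P[x ↔ A]`, (C) the
all-open phases and `τ₀ mod 4`, (D) the face-potential increment across `x` between the two valley faces:
`√3 · (sixthPhase τ₀ · √2 (-1+i)/2 · i^{j+3}) · P[x ↔ A]`. [cite: DuminilCopin2012Parafermion, Proposition 5] -/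
theorem freeTrace_direction (hH : HoleFree {f : Site 2 | E.IsInnerFace f}) :
    ∃ τ₀ : ℤ, ∀ x : Site 2, a * x 0 + b * x 1 = k - 2 → |δ * ((a * x 0 - b * x 1 : ℤ) : ℝ) - t₀| ≤ 5 * wτ / 8 - 4 * δ →
      (∀ (ω : BondConfig (Site 2)) (n : ℕ), n < exitTime hE ω →
        (cornerOrbit (E.bcBondConfig ω) (startCorner hE) n = (x, j) →
          turnCount (E.bcBondConfig ω) (startCorner hE) n = τ₀) ∧
        (cornerOrbit (E.bcBondConfig ω) (startCorner hE) n = (x, j + 1) →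
          turnCount (E.bcBondConfig ω) (startCorner hE) n = τ₀ + 1) ∧
        (cornerOrbit (E.bcBondConfig ω) (startCorner hE) n = (x, j + 3) →
          turnCount (E.bcBondConfig ω) (startCorner hE) n = τ₀ - 1)) ∧
      cornerObs E δ x (faceAt x j) = sixthPhase τ₀ *
        ((bondPercolation (zdGraph 2) half).real {ω | ∃ a ∈ E.zdArcA, (openGraph (E.bcBondConfig ω)).Reachable x a} : ℂ) ∧
      cornerObs E δ x (faceAt x (j + 1)) = sixthPhase (τ₀ + 1) *
        ((bondPercolation (zdGraph 2) half).real {ω | ∃ a ∈ E.zdArcA, (openGraph (E.bcBondConfig ω)).Reachable x a} : ℂ) ∧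
      cornerObs E δ x (faceAt x (j + 3)) = sixthPhase (τ₀ - 1) *
        ((bondPercolation (zdGraph 2) half).real {ω | ∃ a ∈ E.zdArcA, (openGraph (E.bcBondConfig ω)).Reachable x a} : ℂ) ∧
      (0 < (bondPercolation (zdGraph 2) half).real {ω | ∃ a ∈ E.zdArcA, (openGraph (E.bcBondConfig ω)).Reachable x a} →
        cornerPhase δ E x (faceAt x j) (Set.univ : BondConfig (Site 2)) = sixthPhase τ₀ ∧
        cornerPhase δ E x (faceAt x (j + 1)) (Set.univ : BondConfig (Site 2)) = sixthPhase (τ₀ + 1) ∧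
        cornerPhase δ E x (faceAt x (j + 3)) (Set.univ : BondConfig (Site 2)) = sixthPhase (τ₀ - 1) ∧
        τ₀ % 4 = dartDir (startCorner hE) (x, j)) ∧
      cornerObs E δ x (faceAt x (j + 3)) *
          ((medialPoint 1 (cornerTarget x (faceAt x (j + 3))) - medialPoint 1 (cornerSource x (faceAt x (j + 3)))) * (Real.sqrt 2 : ℂ)) -
        cornerObs E δ x (faceAt x (j + 1)) *
          ((medialPoint 1 (cornerTarget x (faceAt x (j + 1))) - medialPoint 1 (cornerSource x (faceAt x (j + 1)))) * (Real.sqrt 2 : ℂ)) =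
        (Real.sqrt 3 : ℂ) * (sixthPhase τ₀ * ((Real.sqrt 2 : ℂ) * ((-1 + I) / 2) * I ^ ((j + 3 : Fin 4) : ℕ))) *
          ((bondPercolation (zdGraph 2) half).real {ω | ∃ a ∈ E.zdArcA, (openGraph (E.bcBondConfig ω)).Reachable x a} : ℂ) := by
  obtain ⟨ha, hb, hl0, hl1, -, -, -⟩ := coords_of_touchIndex hj
  obtain ⟨τ₀, hτ₀⟩ := exists_turnCount_touch hE hj hδ hk' hδν hadj hoff honB hH
  refine ⟨τ₀, fun x hx hxτ => ?_⟩
  have hτx : |δ * ((a * x 0 - b * x 1 : ℤ) : ℝ) - t₀| ≤ 5 * wτ / 8 - 2 * δ := hxτ.trans (by linarith)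
  -- local structure
  have hn0 := near_of_adj ha hb (zdGraph_adj_add_cornerUnit x j)
  have hn1 := near_of_adj ha hb (zdGraph_adj_add_cornerUnit x (j + 1))
  have hB0 : x + cornerUnit j ∈ E.zdArcB := honB _
    (col_of_near (m := 1) hδ.le hn0.2 (by simp only [Nat.cast_one]; linarith))
    (by simp only [Pi.add_apply]; linear_combination hx + hl0)
  have hB1 : x + cornerUnit (j + 1) ∈ E.zdArcB := honB _
    (col_of_near (m := 1) hδ.le hn1.2 (by simp only [Nat.cast_one]; linarith))
    (by simp only [Pi.add_apply]; linear_combination hx + hl1)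
  have hxA : x ∉ E.zdArcA := (not_mem_arcs_of_level hδ hk' hδν hoff hτx (by omega) hx.le).1
  have hface : ∀ i : Fin 4, E.IsInnerFace (faceAt x i) := fun i =>
    isInnerFace_of_touchSite ha hb hδ hk' hδν hadj (isCorner_faceAt x i) hx hτx
  have hy0 : IsCorner (x + cornerUnit (j + 1)) (faceAt x j) :=
    (isCorner_add_faceAt_iff x (j + 1) j).2 (Or.inr (fin4_add_one_add_three j).symm)
  have hy1 : IsCorner (x + cornerUnit (j + 1)) (faceAt x (j + 1)) := (isCorner_add_faceAt_iff x (j + 1) (j + 1)).2 (Or.inl rfl)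
  have hy3 : IsCorner (x + cornerUnit j) (faceAt x (j + 3)) := (isCorner_add_faceAt_iff x j (j + 3)).2 (Or.inr rfl)
  -- (A) the three turn counts
  have hA0 := hτ₀ x hx hxτ
  have hA1 := turnCount_out hE hxA hB1 τ₀ hA0
  have hA3 := turnCount_in hE hB0 (hface j) τ₀ hA0
  -- (B), (C) the evaluations
  obtain ⟨hB0', hC0⟩ := cornerObs_dart_of_turnCount hE hH hδ.ne' (hface j) hy0 hB1 τ₀ hA0
  obtain ⟨hB1', hC1⟩ := cornerObs_dart_of_turnCount hE hH hδ.ne' (hface (j + 1)) hy1 hB1 (τ₀ + 1) hA1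
  obtain ⟨hB3', hC3⟩ := cornerObs_dart_of_turnCount hE hH hδ.ne' (hface (j + 3)) hy3 hB0 (τ₀ - 1) hA3
  refine ⟨fun ω n hn => ⟨hA0 ω n hn, hA1 ω n hn, hA3 ω n hn⟩, hB0', hB1', hB3',
    fun hpos => ⟨hC0 hpos, hC1 hpos, hC3 hpos, ?_⟩, ?_⟩
  · -- the direction of the touch dart pins `τ₀ mod 4`
    have hne : {ω : BondConfig (Site 2) | ∃ a ∈ E.zdArcA, (openGraph (E.bcBondConfig ω)).Reachable x a}.Nonempty := by
      rw [Set.nonempty_iff_ne_empty]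
      exact fun h0 => lt_irrefl (0:ℝ) (by rw [h0, measureReal_empty] at hpos; exact hpos)
    obtain ⟨ω, hω⟩ := hne
    obtain ⟨n, hn, hωn⟩ := (CornerForm.visit_iff_reachable (ω := ω) hE hH (r := (x, j)) (hface j) hy0 hB1).2 hω
    rw [← hA0 ω n hn hωn, turnCount_emod_four n, hωn]
  -- (D) the increment across `x`
  rw [hB3', hB1', dart_dir_faceAt, dart_dir_faceAt]
  have hI : I ^ ((j + 3 : Fin 4) : ℕ) = -(I ^ ((j + 1 : Fin 4) : ℕ)) := by
    rw [← fin4_add_one_add_two, ← fin4_add_one_add_one, I_pow_fin_succ, I_pow_fin_succ, mul_assoc, I_mul_I, mul_neg_one]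
  rw [hI]
  linear_combination (-(((bondPercolation (zdGraph 2) half).real
    {ω | ∃ a ∈ E.zdArcA, (openGraph (E.bcBondConfig ω)).Reachable x a} : ℂ)) *
    ((Real.sqrt 2 : ℂ) * ((-1 + I) / 2) * I ^ ((j + 1 : Fin 4) : ℕ))) * sixthPhase_sub_one_add τ₀

end Wall

/-- **Registered one-line form `freeTrace_direction_diag`** of `freeTrace_direction` (helper of
`stub_traceIdentification`, line `exact-potential-schwarz-christoffel`): one turn count `τ₀` for all touch sites
of a flat diagonal free piece (wall package), the three boundary corner observables `sixthPhase (τ₀, τ₀ ± 1) · P[x ↔ A]`,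
the all-open phases, and the collinear monotone increment `√3 · ζ · P[x ↔ A]` of the face potential across each
touch site. [cite: DuminilCopin2012Parafermion, Proposition 5] -/
theorem freeTrace_direction_diag : ∀ (E : DiscreteDobrushin) (hE : E.IsZdAdmissible) (δ c t₀ wτ wν : ℝ) (a b k : ℤ) (j : Fin 4), HoleFree {f : Site 2 | E.IsInnerFace f} → (Pi.single 0 a + Pi.single 1 b : Site 2) = cornerUnit j + cornerUnit (j + 1) → 0 < δ → c ≤ δ * (k + 1) → 16 * δ ≤ wν → (∀ u w : Site 2, (zdGraph 2).Adj u w → |δ * ((a * u 0 - b * u 1 : ℤ) : ℝ) - t₀| ≤ 5 * wτ / 8 → c - 3 * wν / 4 ≤ δ * ((a * u 0 + b * u 1 : ℤ) : ℝ) → a * u 0 + b * u 1 ≤ k → |δ * ((a * w 0 - b * w 1 : ℤ) : ℝ) - t₀| ≤ 5 * wτ / 8 → c - 3 * wν / 4 ≤ δ * ((a * w 0 + b * w 1 : ℤ) : ℝ) → a * w 0 + b * w 1 ≤ k → (discreteDomainGraph E.Ω E.δ).Adj u w) → (∀ v : Site 2, |δ * ((a * v 0 - b * v 1 : ℤ)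 : ℝ) - t₀| ≤ 5 * wτ / 8 - 2 * δ → c - 3 * wν / 4 + 2 * δ ≤ δ * ((a * v 0 + b * v 1 : ℤ) : ℝ) → a * v 0 + b * v 1 ≤ k - 2 → v ∉ E.zdArcA ∧ v ∉ E.zdArcB) → (∀ y : Site 2, |δ * ((a * y 0 - b * y 1 : ℤ) : ℝ) - t₀| ≤ 5 * wτ / 8 - 2 * δ → a * y 0 + b * y 1 = k - 1 → y ∈ E.zdArcB) → ∃ τ₀ : ℤ, ∀ x : Site 2, a * x 0 + b * x 1 = k - 2 → |δ * ((a * x 0 - b * x 1 : ℤ) : ℝ) - t₀| ≤ 5 * wτ / 8 - 4 * δ → (∀ (ω : BondConfig (Site 2)) (n : ℕ), n < exitTime hE ω → (cornerOrbit (E.bcBondConfig ω) (startCorner hE) n = (x, j) → turnCount (E.bcBondConfig ω) (startCorner hE) n = τ₀) ∧ (cornerOrbit (E.bcBondConfig ω) (startCorner hE) n = (x, j + 1) → turnCount (E.bcBondConfig ω) (startCorner hE) n = τ₀ + 1) ∧ (cornerOrbit (E.bcBondConfig ω) (startCorner hE) n = (x, j + 3) → turnCount (E.bcBondConfig ω)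 (startCorner hE) n = τ₀ - 1)) ∧ cornerObs E δ x (faceAt x j) = sixthPhase τ₀ * ((bondPercolation (zdGraph 2) half).real {ω | ∃ a ∈ E.zdArcA, (openGraph (E.bcBondConfig ω)).Reachable x a} : ℂ) ∧ cornerObs E δ x (faceAt x (j + 1)) = sixthPhase (τ₀ + 1) * ((bondPercolation (zdGraph 2) half).real {ω | ∃ a ∈ E.zdArcA, (openGraph (E.bcBondConfig ω)).Reachable x a} : ℂ) ∧ cornerObs E δ x (faceAt x (j + 3)) = sixthPhase (τ₀ - 1) * ((bondPercolation (zdGraph 2) half).real {ω | ∃ a ∈ E.zdArcA, (openGraph (E.bcBondConfig ω)).Reachable x a} : ℂ) ∧ (0 < (bondPercolation (zdGraph 2) half).real {ω | ∃ a ∈ E.zdArcA, (openGraph (E.bcBondConfig ω)).Reachable x a} → cornerPhase δ E x (faceAt x j) (Set.univ : BondConfig (Site 2)) = sixthPhase τ₀ ∧ cornerPhase δ E x (faceAt x (j + 1)) (Set.univ : BondConfig (Site 2)) = sixthPhase (τ₀ + 1) ∧ cornerPhase δ E x (faceAt x (j + 3)) (Set.univ : BondConfig (Site 2)) = sixthPhase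 (τ₀ - 1) ∧ τ₀ % 4 = dartDir (startCorner hE) (x, j)) ∧ cornerObs E δ x (faceAt x (j + 3)) * ((medialPoint 1 (cornerTarget x (faceAt x (j + 3))) - medialPoint 1 (cornerSource x (faceAt x (j + 3)))) * (Real.sqrt 2 : ℂ)) - cornerObs E δ x (faceAt x (j + 1)) * ((medialPoint 1 (cornerTarget x (faceAt x (j + 1))) - medialPoint 1 (cornerSource x (faceAt x (j + 1)))) * (Real.sqrt 2 : ℂ)) = (Real.sqrt 3 : ℂ) * (sixthPhase τ₀ * ((Real.sqrt 2 : ℂ) * ((-1 + Complex.I) / 2) * Complex.I ^ ((j + 3 : Fin 4) : ℕ))) * ((bondPercolation (zdGraph 2) half).real {ω | ∃ a ∈ E.zdArcA, (openGraph (E.bcBondConfig ω)).Reachable x a} : ℂ) :=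
  fun _ hE _ _ _ _ _ _ _ _ _ hH hj hδ hk' hδν hadj hoff honB =>
    freeTrace_direction hE hj hδ hk' hδν hadj hoff honB hH

end Summit.CriticalPhenomena.CardyFormulaZ2.Theorems.ParafermionFamiliesToSLESix.FreeTrace

end
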